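/-
Copyright: harness tree, Literature layer (sorry-free). b2b-lace enum1-g52 (ENUMERATION SHARD A gen 52),
node KU-SEP-SEED-K2: semantics of the PRODUCT-ROW twisted SEEDCERT kernel (table, Horner and majorant layers).
-/
import Literature.Probability.FitznerVanDerHofstad2017.SrwTwistProdCertKernel
import Literature.Probability.FitznerVanDerHofstad2017.SrwTwistSeedCertSemantics
import HarnessLib

/-!
# Product-row twisted SEEDCERT kernel: semantics of the table layer

Companion of `SrwTwistProdCertKernel` (the computable layer) and generalisation of
`SrwTwistSeedCertSemantics` from ONE twisted row `G^D` to a product `F = ∏_r G_{a_r}^{p_r}` of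
cos-power CLASS rows.  For a class `a` the formal EGF is `G_a(s) = Σ_N φ_a(N) s^N/N!` with the
Gaussian-integer numerator `φ_a(N) = Σ_{j ≤ J} Σ_{s ≤ a} ε_j i^j Q_j C(a,s) · walk1(N, |jm + a - 2s|)`
(`twRowC2`, `twG2`); its coefficients have the PARITY PAIR `(a mod 2, (a+m) mod 2)` (`ParityC2 ρ σ`:
real parts live on exponents `≡ ρ`, imaginary parts on exponents `≡ σ (mod 2)`).  Parity pairs multiply
(`parityC2_mul`: `(ρ₁,σ₁)·(ρ₂,σ₂) = (ρ₁+ρ₂, ρ₁+σ₂)` when `ρ₁+σ₁ ≡ ρ₂+σ₂`), and the general parity-pair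
Gaussian product `gzMul2`/`gzMulP` of the kernel preserves the table invariant `TwInv2`
(real entry `k` = `M̂!·Re[s^{2k+ρ}]H`, imaginary entry `k` = `M̂!·Im[s^{2k+σ}]H`; `twInv2_gzMulP`), whence
`gzPow2` computes powers (`twInv2_gzPow2`), `gzClass` the class tables and the fold `gzProd` the product
table of `F = prF cls` (`PrCert.tableP_spec`).  The Horner sums `PqP`, `UqP` are then the exact truncated
moment sums of `F` (`PrCert.PqP_real`, `PrCert.UqP_real`), and the majorant
`‖N!·[s^N]F‖ ≤ q^{Σp} 2^{Σpa} (2Σp)^N` (`norm_coeff_prF_le`) holds by `MajC` closure under products, from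
the class-row bound `‖φ_a(N)‖ ≤ q 2^a 2^N` (at most `2^N` walks end in the `2J+1` distinct sites
`c + jm`, `|j| ≤ J`, for each of the `2^a` shifted copies).  Finally the analytic identification
`Σ_N [s^N]F · s^N = ∏_r Φ_{a_r}(s)^{p_r}`, `Φ_a(s) = Σ_j Σ_s ε_j i^j Q_j C(a,s) I_{|jm+a-2s|}(2s)`
(`hasSum_coeff_prF`).  Everything is stated for a general class list; number-free.
[cite: FitznerVanDerHofstad2016NoBLE, §5.1.1 (5.4)–(5.5) pp. 1089–1090]
-/

set_option Elab.async false

namespace Literature.Probability.FitznerVanDerHofstad2017.SeedCert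

open Finset
open scoped Nat

/-! ## Part 1. Parity pairs -/

/-- **Shifted parity-supported antidiagonal sums**: if `f` lives on `a ≡ α (mod 2)` and
`α + β = 2e + γ` (`α, β ∈ {0,1}`), then `Σ_{a+b = 2k+γ} f(a) g(b) = [e ≤ k] Σ_{i ≤ k-e} f(2i+α) g(2(k-e-i)+β)`.
[cite: FitznerVanDerHofstad2016NoBLE, §5.1.1 (5.4)–(5.5) pp. 1089–1090] -/
theorem sum_antidiag_shift (f g : ℕ → ℝ) {α β e γ : ℕ} (hα : α < 2) (hβ : β < 2)
    (he : α + β = 2 * e + γ) (hf : ∀ a, a % 2 ≠ α → f a = 0) (k : ℕ) :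
    ∑ x ∈ antidiagonal (2 * k + γ), f x.1 * g x.2
      = if e ≤ k then ∑ i ∈ range (k - e + 1), f (2 * i + α) * g (2 * (k - e - i) + β) else 0 := by
  split_ifs with hek
  · have := sum_antidiagonal_parity f g hα hβ hf (k - e)
    rw [show 2 * (k - e) + α + β = 2 * k + γ by omega] at this
    exact this
  · have hk : k = 0 := by omega
    have hγ : γ = 0 := by omega
    subst hk; subst hγ
    rw [mul_zero, add_zero, Nat.antidiagonal_zero, sum_singleton]
    dsimp only
    rw [hf 0 (by omega), zero_mul]

/-- Parity-pair structure of a formal series: real parts on exponents `≡ ρ`, imaginary parts on exponents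
`≡ σ (mod 2)`. [cite: FitznerVanDerHofstad2016NoBLE, §5.1.1 (5.4)–(5.5) pp. 1089–1090] -/
def ParityC2 (ρ σ : ℕ) (H : PowerSeries ℂ) : Prop :=
  (∀ N, N % 2 ≠ ρ → (PowerSeries.coeff N H).re = 0) ∧ (∀ N, N % 2 ≠ σ → (PowerSeries.coeff N H).im = 0)

/-- `ParityC σ` is `ParityC2 0 σ`. [cite: FitznerVanDerHofstad2016NoBLE, §5.1.1 (5.4)–(5.5) pp. 1089–1090] -/
theorem parityC2_of_parityC {σ : ℕ} {H : PowerSeries ℂ} (h : ParityC σ H) : ParityC2 0 σ H := h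

/-- The parity pairs multiply: `(ρ₁,σ₁)·(ρ₂,σ₂) = (ρ₁+ρ₂, ρ₁+σ₂)` (consistent pairs, `ρ₁+σ₁ ≡ ρ₂+σ₂`).
[cite: FitznerVanDerHofstad2016NoBLE, §5.1.1 (5.4)–(5.5) pp. 1089–1090] -/
theorem parityC2_mul {ρ₁ σ₁ ρ₂ σ₂ : ℕ} {G H : PowerSeries ℂ} (hc : (ρ₁ + σ₁) % 2 = (ρ₂ + σ₂) % 2)
    (hG : ParityC2 ρ₁ σ₁ G) (hH : ParityC2 ρ₂ σ₂ H) :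
    ParityC2 ((ρ₁ + ρ₂) % 2) ((ρ₁ + σ₂) % 2) (G * H) := by
  constructor
  · intro N hN
    rw [PowerSeries.coeff_mul, Complex.re_sum]
    refine sum_eq_zero fun x hx => ?_
    rw [mem_antidiagonal] at hx
    rw [Complex.mul_re]
    have h1 : (PowerSeries.coeff x.1 G).re * (PowerSeries.coeff x.2 H).re = 0 := by
      by_cases h : x.1 % 2 = ρ₁
      · rw [hH.1 x.2 (by omega), mul_zero]
      · rw [hG.1 x.1 h, zero_mul]
    have h2 : (PowerSeries.coeff x.1 G).im * (PowerSeries.coeff x.2 H).im = 0 := by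
      by_cases h : x.1 % 2 = σ₁
      · rw [hH.2 x.2 (by omega), mul_zero]
      · rw [hG.2 x.1 h, zero_mul]
    rw [h1, h2, sub_zero]
  · intro N hN
    rw [PowerSeries.coeff_mul, Complex.im_sum]
    refine sum_eq_zero fun x hx => ?_
    rw [mem_antidiagonal] at hx
    rw [Complex.mul_im]
    have h1 : (PowerSeries.coeff x.1 G).re * (PowerSeries.coeff x.2 H).im = 0 := by
      by_cases h : x.1 % 2 = ρ₁
      · rw [hH.2 x.2 (by omega), mul_zero]
      · rw [hG.1 x.1 h, zero_mul]
    have h2 : (PowerSeries.coeff x.1 G).im * (PowerSeries.coeff x.2 H).re = 0 := by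
      by_cases h : x.1 % 2 = σ₁
      · rw [hH.1 x.2 (by omega), mul_zero]
      · rw [hG.2 x.1 h, zero_mul]
    rw [h1, h2, add_zero]

/-- `rhoP ρ p < 2`. [cite: FitznerVanDerHofstad2016NoBLE, §5.1.1 (5.4)–(5.5) pp. 1089–1090] -/
theorem rhoP_lt (ρ p : ℕ) : rhoP ρ p < 2 := Nat.mod_lt _ two_pos

/-- `sigP ρ σ p < 2`. [cite: FitznerVanDerHofstad2016NoBLE, §5.1.1 (5.4)–(5.5) pp. 1089–1090] -/
theorem sigP_lt (ρ σ p : ℕ) : sigP ρ σ p < 2 := Nat.mod_lt _ two_pos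

/-- The power parity pair is consistent with the base pair. [cite: FitznerVanDerHofstad2016NoBLE, §5.1.1 (5.4)–(5.5) pp. 1089–1090] -/
theorem rhoP_add_sigP {ρ : ℕ} (hρ : ρ < 2) (σ p : ℕ) : (rhoP ρ p + sigP ρ σ p) % 2 = (ρ + σ) % 2 := by
  unfold rhoP sigP; interval_cases ρ <;> omega

/-- `rhoP ρ 1 = ρ`. [cite: FitznerVanDerHofstad2016NoBLE, §5.1.1 (5.4)–(5.5) pp. 1089–1090] -/
theorem rhoP_one {ρ : ℕ} (hρ : ρ < 2) : rhoP ρ 1 = ρ := by unfold rhoP; omega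

/-- `sigP ρ σ 1 = σ`. [cite: FitznerVanDerHofstad2016NoBLE, §5.1.1 (5.4)–(5.5) pp. 1089–1090] -/
theorem sigP_one (ρ : ℕ) {σ : ℕ} (hσ : σ < 2) : sigP ρ σ 1 = σ := by unfold sigP; omega

/-- Squaring step of the power parities. [cite: FitznerVanDerHofstad2016NoBLE, §5.1.1 (5.4)–(5.5) pp. 1089–1090] -/
theorem rhoP_half {ρ p : ℕ} (hρ : ρ < 2) (hp : p % 2 = 0) :
    (rhoP ρ (p / 2) + rhoP ρ (p / 2)) % 2 = rhoP ρ p := by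
  unfold rhoP; interval_cases ρ <;> omega

/-- Squaring step of the power parities (imaginary). [cite: FitznerVanDerHofstad2016NoBLE, §5.1.1 (5.4)–(5.5) pp. 1089–1090] -/
theorem sigP_half {ρ p : ℕ} (hρ : ρ < 2) (σ : ℕ) (hp : p % 2 = 0) :
    (rhoP ρ (p / 2) + sigP ρ σ (p / 2)) % 2 = sigP ρ σ p := by
  unfold rhoP sigP; interval_cases ρ <;> omega

/-- Successor step of the power parities (from `p-1`). [cite: FitznerVanDerHofstad2016NoBLE, §5.1.1 (5.4)–(5.5) pp. 1089–1090] -/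
theorem rhoP_pred {ρ p : ℕ} (hρ : ρ < 2) (hp : 1 ≤ p) : (ρ + rhoP ρ (p - 1)) % 2 = rhoP ρ p := by
  unfold rhoP; interval_cases ρ <;> omega

/-- Successor step of the power parities (imaginary, from `p-1`). [cite: FitznerVanDerHofstad2016NoBLE, §5.1.1 (5.4)–(5.5) pp. 1089–1090] -/
theorem sigP_pred {ρ p : ℕ} (hρ : ρ < 2) (σ : ℕ) (hp : 1 ≤ p) : (ρ + sigP ρ σ (p - 1)) % 2 = sigP ρ σ p := by
  unfold sigP; interval_cases ρ <;> omega

/-- Successor step of the power parities (to `p+1`). [cite: FitznerVanDerHofstad2016NoBLE, §5.1.1 (5.4)–(5.5) pp. 1089–1090] -/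
theorem rhoP_succ {ρ : ℕ} (hρ : ρ < 2) (p : ℕ) : (rhoP ρ p + ρ) % 2 = rhoP ρ (p + 1) := by
  unfold rhoP; interval_cases ρ <;> omega

/-- Successor step of the power parities (imaginary, to `p+1`). [cite: FitznerVanDerHofstad2016NoBLE, §5.1.1 (5.4)–(5.5) pp. 1089–1090] -/
theorem sigP_succ {ρ : ℕ} (hρ : ρ < 2) (σ p : ℕ) : (rhoP ρ p + σ) % 2 = sigP ρ σ (p + 1) := by
  unfold rhoP sigP; interval_cases ρ <;> omega

/-- **Parity pairs of the powers**: `H^p` has the pair `(rhoP ρ p, sigP ρ σ p)`.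
[cite: FitznerVanDerHofstad2016NoBLE, §5.1.1 (5.4)–(5.5) pp. 1089–1090] -/
theorem parityC2_pow {ρ σ : ℕ} (hρ : ρ < 2) {H : PowerSeries ℂ} (hH : ParityC2 ρ σ H) :
    ∀ p : ℕ, ParityC2 (rhoP ρ p) (sigP ρ σ p) (H ^ p)
  | 0 => by
      rw [pow_zero, show rhoP ρ 0 = 0 by simp [rhoP]]
      exact parityC2_of_parityC (parityC_one _)
  | p + 1 => by
      rw [pow_succ, ← rhoP_succ hρ p, ← sigP_succ hρ σ p]
      exact parityC2_mul (rhoP_add_sigP hρ σ p) (parityC2_pow hρ hH p) hH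


/-! ## Part 2. The parity-pair Gaussian product `gzMul2` -/

/-- The undivided real product coefficient of `gzMul2`:
`[eRR ≤ k] Σ_{i ≤ k-eRR} a_i c_{k-eRR-i} - [eII ≤ k] Σ_{i ≤ k-eII} b_i d_{k-eII-i}`.
[cite: FitznerVanDerHofstad2016NoBLE, §5.1.1 (5.4)–(5.5) pp. 1089–1090] -/
def prodRe2 (eRR eII : ℕ) (X Y : GZ) (k : ℕ) : ℤ :=
  (if eRR ≤ k then ∑ i ∈ range (k - eRR + 1), zval X.1 i * zval Y.1 (k - eRR - i) else 0)
    - (if eII ≤ k then ∑ i ∈ range (k - eII + 1), zval X.2 i * zval Y.2 (k - eII - i) else 0)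

/-- The undivided imaginary product coefficient of `gzMul2`:
`[eRI ≤ k] Σ a_i d_{k-eRI-i} + [eIR ≤ k] Σ b_i c_{k-eIR-i}`.
[cite: FitznerVanDerHofstad2016NoBLE, §5.1.1 (5.4)–(5.5) pp. 1089–1090] -/
def prodIm2 (eRI eIR : ℕ) (X Y : GZ) (k : ℕ) : ℤ :=
  (if eRI ≤ k then ∑ i ∈ range (k - eRI + 1), zval X.1 i * zval Y.2 (k - eRI - i) else 0)
    + (if eIR ≤ k then ∑ i ∈ range (k - eIR + 1), zval X.2 i * zval Y.1 (k - eIR - i) else 0)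

/-- `gzMul2 … L` returns lists of length `L`. [cite: FitznerVanDerHofstad2016NoBLE, §5.1.1 (5.4)–(5.5) pp. 1089–1090] -/
theorem gzMul2_len (eRR eII eRI eIR Mf L : ℕ) (X Y : GZ) : GZlen (gzMul2 eRR eII eRI eIR Mf L X Y) L := by
  have hm := fun (P Q : List ℕ × List ℕ) => length_mulPN P Q L
  have hs := fun (e : ℕ) (P Q : List ℕ × List ℕ) =>
    length_shiftPN e L (mulPN P Q L) (by rw [(hm P Q).1]; omega) (by rw [(hm P Q).2]; omega)
  refine ⟨?_, ?_, ?_, ?_⟩ <;>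
    simp only [gzMul2, forcePN_eq, (length_divPN _ _).1, (length_divPN _ _).2, (length_normPN _).1,
      (length_normPN _).2, (length_subPN _ _).1, (length_subPN _ _).2, (length_addPN _ _).1,
      (length_addPN _ _).2, (hs _ _ _).1, (hs _ _ _).2, max_self]

/-- **Real part of `gzMul2`**: the exact quotient `prodRe2 / Mf` when `Mf ∣ prodRe2`.
[cite: FitznerVanDerHofstad2016NoBLE, §5.1.1 (5.4)–(5.5) pp. 1089–1090] -/
theorem zval_gzMul2_re (eRR eII eRI eIR Mf L : ℕ) (X Y : GZ) (hX : GZlen X L) (hY : GZlen Y L) (k : ℕ)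
    (hk : k < L) (hdvd : (Mf : ℤ) ∣ prodRe2 eRR eII X Y k) :
    zval (gzMul2 eRR eII eRI eIR Mf L X Y).1 k = prodRe2 eRR eII X Y k / Mf := by
  obtain ⟨hx1, hx2, hx3, hx4⟩ := hX
  obtain ⟨hy1, hy2, hy3, hy4⟩ := hY
  have hre : zval (normPN (subPN (shiftPN eRR L (mulPN X.1 Y.1 L)) (shiftPN eII L (mulPN X.2 Y.2 L)))) k
      = prodRe2 eRR eII X Y k := by
    rw [zval_normPN, zval_subPN, zval_shiftPN eRR L _ k hk, zval_shiftPN eII L _ k hk, prodRe2]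
    congr 1
    · split_ifs with h
      · exact zval_mulPN _ _ L hx1.le hx2.le hy1.le hy2.le (k - eRR) (by omega)
      · rfl
    · split_ifs with h
      · exact zval_mulPN _ _ L hx3.le hx4.le hy3.le hy4.le (k - eII) (by omega)
      · rfl
  simp only [gzMul2, forcePN_eq]
  rw [zval_divPN_of_dvd Mf _ k (normPN_disjoint _ _) (hre ▸ hdvd), hre]

/-- **Imaginary part of `gzMul2`**: the exact quotient `prodIm2 / Mf` when `Mf ∣ prodIm2`.
[cite: FitznerVanDerHofstad2016NoBLE, §5.1.1 (5.4)–(5.5) pp. 1089–1090] -/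
theorem zval_gzMul2_im (eRR eII eRI eIR Mf L : ℕ) (X Y : GZ) (hX : GZlen X L) (hY : GZlen Y L) (k : ℕ)
    (hk : k < L) (hdvd : (Mf : ℤ) ∣ prodIm2 eRI eIR X Y k) :
    zval (gzMul2 eRR eII eRI eIR Mf L X Y).2 k = prodIm2 eRI eIR X Y k / Mf := by
  obtain ⟨hx1, hx2, hx3, hx4⟩ := hX
  obtain ⟨hy1, hy2, hy3, hy4⟩ := hY
  have him : zval (normPN (addPN (shiftPN eRI L (mulPN X.1 Y.2 L)) (shiftPN eIR L (mulPN X.2 Y.1 L)))) k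
      = prodIm2 eRI eIR X Y k := by
    rw [zval_normPN, zval_addPN, zval_shiftPN eRI L _ k hk, zval_shiftPN eIR L _ k hk, prodIm2]
    congr 1
    · split_ifs with h
      · exact zval_mulPN _ _ L hx1.le hx2.le hy3.le hy4.le (k - eRI) (by omega)
      · rfl
    · split_ifs with h
      · exact zval_mulPN _ _ L hx3.le hx4.le hy1.le hy2.le (k - eIR) (by omega)
      · rfl
  simp only [gzMul2, forcePN_eq]
  rw [zval_divPN_of_dvd Mf _ k (normPN_disjoint _ _) (him ▸ hdvd), him]

/-- **The parity-pair table invariant**: lengths `K+1`; real entry `k ≤ K` is `M̂! · Re [s^{2k+ρ}] H`,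
imaginary entry `k ≤ K` is `M̂! · Im [s^{2k+σ}] H`. [cite: FitznerVanDerHofstad2016NoBLE, §5.1.1 (5.4)–(5.5) pp. 1089–1090] -/
structure TwInv2 (Mh K ρ σ : ℕ) (H : PowerSeries ℂ) (X : GZ) : Prop where
  len : GZlen X (K + 1)
  re : ∀ k, k ≤ K → (zval X.1 k : ℝ) = (Mh ! : ℝ) * (PowerSeries.coeff (2 * k + ρ) H).re
  im : ∀ k, k ≤ K → (zval X.2 k : ℝ) = (Mh ! : ℝ) * (PowerSeries.coeff (2 * k + σ) H).im

/-- `TwInv … σ G p` is `TwInv2 … 0 σ (G^p)`. [cite: FitznerVanDerHofstad2016NoBLE, §5.1.1 (5.4)–(5.5) pp. 1089–1090] -/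
theorem twInv2_of_twInv {Mh K σ : ℕ} {G : PowerSeries ℂ} {p : ℕ} {X : GZ} (h : TwInv Mh K σ G p X) :
    TwInv2 Mh K 0 σ (G ^ p) X :=
  ⟨h.len, fun k hk => by rw [add_zero]; exact h.re k hk, h.im⟩

/-- A cast of a guarded integer sum against the invariant values. [cite: FitznerVanDerHofstad2016NoBLE, §5.1.1 (5.4)–(5.5) pp. 1089–1090] -/
theorem cast_guardSum (M : ℝ) (e k : ℕ) (u v : ℕ → ℤ) (f g : ℕ → ℝ)
    (hu : ∀ i, i ≤ k → (u i : ℝ) = M * f i) (hv : ∀ i, i ≤ k → (v i : ℝ) = M * g i) :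
    (((if e ≤ k then ∑ i ∈ range (k - e + 1), u i * v (k - e - i) else 0 : ℤ)) : ℝ)
      = M * M * (if e ≤ k then ∑ i ∈ range (k - e + 1), f i * g (k - e - i) else 0) := by
  split_ifs with h
  · push_cast
    rw [mul_sum]
    refine sum_congr rfl fun i hi => ?_
    rw [mem_range] at hi
    rw [hu i (by omega), hv (k - e - i) (by omega)]
    ring
  · simp

/-- **`gzMulP` preserves the table invariant**: `Θ(G) · Θ(H) / M̂! = Θ(G·H)` with the product parity
pair. [cite: FitznerVanDerHofstad2016NoBLE, §5.1.1 (5.4)–(5.5) pp. 1089–1090] -/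
theorem twInv2_gzMulP {Mh K ρ₁ σ₁ ρ₂ σ₂ : ℕ} {G H : PowerSeries ℂ} (hMh : Mh = 2 * K + 1)
    (hρ₁ : ρ₁ < 2) (hσ₁ : σ₁ < 2) (hρ₂ : ρ₂ < 2) (hσ₂ : σ₂ < 2) (hc : (ρ₁ + σ₁) % 2 = (ρ₂ + σ₂) % 2)
    (hpG : ParityC2 ρ₁ σ₁ G) (hiG : IntC G) (hiH : IntC H) {X Y : GZ}
    (hX : TwInv2 Mh K ρ₁ σ₁ G X) (hY : TwInv2 Mh K ρ₂ σ₂ H Y) :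
    TwInv2 Mh K ((ρ₁ + ρ₂) % 2) ((ρ₁ + σ₂) % 2) (G * H) (gzMulP (Mh !) (K + 1) ρ₁ σ₁ ρ₂ σ₂ X Y) := by
  have hI := intC_mul hiG hiH
  have hMf : Mh ! ≠ 0 := (Nat.factorial_pos _).ne'
  show TwInv2 Mh K _ _ (G * H) (gzMul2 ((ρ₁ + ρ₂) / 2) ((σ₁ + σ₂) / 2) ((ρ₁ + σ₂) / 2)
    ((σ₁ + ρ₂) / 2) (Mh !) (K + 1) X Y)
  refine ⟨gzMul2_len _ _ _ _ _ _ X Y, fun k hk => ?_, fun k hk => ?_⟩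
  · -- the real identity
    have hRR := sum_antidiag_shift (fun a => (PowerSeries.coeff a G).re)
      (fun b => (PowerSeries.coeff b H).re) (e := (ρ₁ + ρ₂) / 2) (γ := (ρ₁ + ρ₂) % 2) hρ₁ hρ₂
      (by omega) (fun a ha => hpG.1 a ha) k
    have hII := sum_antidiag_shift (fun a => (PowerSeries.coeff a G).im)
      (fun b => (PowerSeries.coeff b H).im) (e := (σ₁ + σ₂) / 2) (γ := (ρ₁ + ρ₂) % 2) hσ₁ hσ₂
      (by omega) (fun a ha => hpG.2 a ha) k
    have h1 := cast_guardSum (Mh ! : ℝ) ((ρ₁ + ρ₂) / 2) k (fun i => zval X.1 i) (fun i => zval Y.1 i)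
      (fun i => (PowerSeries.coeff (2 * i + ρ₁) G).re) (fun i => (PowerSeries.coeff (2 * i + ρ₂) H).re)
      (fun i hi => hX.re i (by omega)) (fun i hi => hY.re i (by omega))
    have h2 := cast_guardSum (Mh ! : ℝ) ((σ₁ + σ₂) / 2) k (fun i => zval X.2 i) (fun i => zval Y.2 i)
      (fun i => (PowerSeries.coeff (2 * i + σ₁) G).im) (fun i => (PowerSeries.coeff (2 * i + σ₂) H).im)
      (fun i hi => hX.im i (by omega)) (fun i hi => hY.im i (by omega))
    have hre : (prodRe2 ((ρ₁ + ρ₂) / 2) ((σ₁ + σ₂) / 2) X Y k : ℝ) = (Mh ! : ℝ) * ((Mh ! : ℝ)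
        * (PowerSeries.coeff (2 * k + (ρ₁ + ρ₂) % 2) (G * H)).re) := by
      rw [PowerSeries.coeff_mul, Complex.re_sum]
      simp only [Complex.mul_re]
      rw [sum_sub_distrib, hRR, hII, prodRe2, Int.cast_sub, h1, h2]
      ring
    obtain ⟨z, hz⟩ := intC_re hI (show 2 * k + (ρ₁ + ρ₂) % 2 ≤ Mh by omega)
    rw [hz] at hre
    obtain ⟨hdvd, hq⟩ := int_quot_of_real_eq hMf hre
    rw [zval_gzMul2_re _ _ _ _ (Mh !) (K + 1) X Y hX.len hY.len k (by omega) hdvd, hq, hz]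
  · -- the imaginary identity
    have hRI := sum_antidiag_shift (fun a => (PowerSeries.coeff a G).re)
      (fun b => (PowerSeries.coeff b H).im) (e := (ρ₁ + σ₂) / 2) (γ := (ρ₁ + σ₂) % 2) hρ₁ hσ₂
      (by omega) (fun a ha => hpG.1 a ha) k
    have hIR := sum_antidiag_shift (fun a => (PowerSeries.coeff a G).im)
      (fun b => (PowerSeries.coeff b H).re) (e := (σ₁ + ρ₂) / 2) (γ := (ρ₁ + σ₂) % 2) hσ₁ hρ₂
      (by omega) (fun a ha => hpG.2 a ha) k
    have h1 := cast_guardSum (Mh ! : ℝ) ((ρ₁ + σ₂) / 2) k (fun i => zval X.1 i) (fun i => zval Y.2 i)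
      (fun i => (PowerSeries.coeff (2 * i + ρ₁) G).re) (fun i => (PowerSeries.coeff (2 * i + σ₂) H).im)
      (fun i hi => hX.re i (by omega)) (fun i hi => hY.im i (by omega))
    have h2 := cast_guardSum (Mh ! : ℝ) ((σ₁ + ρ₂) / 2) k (fun i => zval X.2 i) (fun i => zval Y.1 i)
      (fun i => (PowerSeries.coeff (2 * i + σ₁) G).im) (fun i => (PowerSeries.coeff (2 * i + ρ₂) H).re)
      (fun i hi => hX.im i (by omega)) (fun i hi => hY.re i (by omega))
    have him : (prodIm2 ((ρ₁ + σ₂) / 2) ((σ₁ + ρ₂) / 2) X Y k : ℝ) = (Mh ! : ℝ) * ((Mh ! : ℝ)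
        * (PowerSeries.coeff (2 * k + (ρ₁ + σ₂) % 2) (G * H)).im) := by
      rw [PowerSeries.coeff_mul, Complex.im_sum]
      simp only [Complex.mul_im]
      rw [sum_add_distrib, hRI, hIR, prodIm2, Int.cast_add, h1, h2]
      ring
    obtain ⟨z, hz⟩ := intC_im hI (show 2 * k + (ρ₁ + σ₂) % 2 ≤ Mh by omega)
    rw [hz] at him
    obtain ⟨hdvd, hq⟩ := int_quot_of_real_eq hMf him
    rw [zval_gzMul2_im _ _ _ _ (Mh !) (K + 1) X Y hX.len hY.len k (by omega) hdvd, hq, hz]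


/-! ### Binary powering with parity pairs -/

/-- **`gzPow2Aux` computes the powers** `H^p` with their parity pairs (`1 ≤ p ≤ fuel + 1`).
[cite: FitznerVanDerHofstad2016NoBLE, §5.1.1 (5.4)–(5.5) pp. 1089–1090] -/
theorem twInv2_gzPow2Aux {Mh K ρ σ : ℕ} {H : PowerSeries ℂ} (hMh : Mh = 2 * K + 1) (hρ : ρ < 2)
    (hσ : σ < 2) (hpar : ParityC2 ρ σ H) (hint : IntC H) {R : GZ} (hR : TwInv2 Mh K ρ σ H R) :
    ∀ fuel p : ℕ, 1 ≤ p → p ≤ fuel + 1 →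
      TwInv2 Mh K (rhoP ρ p) (sigP ρ σ p) (H ^ p) (gzPow2Aux ρ σ (Mh !) (K + 1) R fuel p)
  | 0, p, h1, h2 => by
      obtain rfl : p = 1 := by omega
      rw [gzPow2Aux, pow_one, rhoP_one hρ, sigP_one ρ hσ]
      exact hR
  | fuel + 1, p, h1, h2 => by
      rw [gzPow2Aux]
      cases hb : Nat.ble p 1 with
      | true =>
          obtain rfl : p = 1 := by have := Nat.le_of_ble_eq_true hb; omega
          rw [pow_one, rhoP_one hρ, sigP_one ρ hσ]
          exact hR
      | false =>
          have hp : ¬ p ≤ 1 := fun h => by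
            rw [Nat.ble_eq_true_of_le h] at hb; exact Bool.noConfusion hb
          by_cases he : p % 2 = 0
          · have hbeq : (p % 2 == 0) = true := by simp [he]
            rw [hbeq]
            have hH := twInv2_gzPow2Aux hMh hρ hσ hpar hint hR fuel (p / 2) (by omega) (by omega)
            have := twInv2_gzMulP hMh (rhoP_lt _ _) (sigP_lt _ _ _) (rhoP_lt _ _) (sigP_lt _ _ _) rfl
              (parityC2_pow hρ hpar _) (intC_pow hint _) (intC_pow hint _) hH hH
            rw [← pow_add, show p / 2 + p / 2 = p by omega, rhoP_half hρ he, sigP_half hρ σ he] at this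
            exact this
          · have hbeq : (p % 2 == 0) = false := by simp [he]
            rw [hbeq]
            have h1' := twInv2_gzPow2Aux hMh hρ hσ hpar hint hR fuel (p - 1) (by omega) (by omega)
            have := twInv2_gzMulP hMh hρ hσ (rhoP_lt _ _) (sigP_lt _ _ _)
              (rhoP_add_sigP hρ σ (p - 1)).symm hpar hint (intC_pow hint _) hR h1'
            rw [← pow_succ', show p - 1 + 1 = p by omega, rhoP_pred hρ (by omega),
              sigP_pred hρ σ (by omega)] at this
            exact this

/-- **`gzPow2` computes `H^p`** (`1 ≤ p`) with its parity pair. [cite: FitznerVanDerHofstad2016NoBLE, §5.1.1 (5.4)–(5.5) pp. 1089–1090] -/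
theorem twInv2_gzPow2 {Mh K ρ σ : ℕ} {H : PowerSeries ℂ} (hMh : Mh = 2 * K + 1) (hρ : ρ < 2)
    (hσ : σ < 2) (hpar : ParityC2 ρ σ H) (hint : IntC H) {R : GZ} (hR : TwInv2 Mh K ρ σ H R)
    (p : ℕ) (hp : 1 ≤ p) :
    TwInv2 Mh K (rhoP ρ p) (sigP ρ σ p) (H ^ p) (gzPow2 ρ σ (Mh !) (K + 1) R p) :=
  twInv2_gzPow2Aux hMh hρ hσ hpar hint hR p p hp (by omega)


/-! ## Part 3. The class rows -/

/-- Flattening of a double sum over `range n × range (k+1)`. [cite: FitznerVanDerHofstad2016NoBLE, §5.1.1 (5.4)–(5.5) pp. 1089–1090] -/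
theorem sum_flat {M : Type*} [AddCommMonoid M] (g : ℕ → ℕ → M) (k : ℕ) :
    ∀ n : ℕ, ∑ i ∈ range (n * (k + 1)), g (i / (k + 1)) (i % (k + 1))
      = ∑ j ∈ range n, ∑ s ∈ range (k + 1), g j s
  | 0 => by simp
  | n + 1 => by
      rw [Nat.succ_mul, sum_range_add, sum_flat g k n,
        sum_range_succ (fun j => ∑ s ∈ range (k + 1), g j s) n]
      show _ = ∑ j ∈ range n, ∑ s ∈ range (k + 1), g j s + ∑ s ∈ range (k + 1), g n s
      congr 1
      refine sum_congr rfl fun s hs => ?_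
      rw [mem_range] at hs
      rw [add_comm (n * (k + 1)) s, Nat.add_mul_div_right _ _ (by omega : 0 < k + 1),
        Nat.add_mul_mod_self_right, Nat.div_eq_of_lt hs, Nat.mod_eq_of_lt hs, zero_add]

/-- **The class-row numerator** `φ_a(N) = Σ_{j ≤ J} Σ_{s ≤ a} ε_j i^j Q_j C(a,s) walk1(N, |jm+a-2s|) ∈ ℤ[i]`.
[cite: FitznerVanDerHofstad2016NoBLE, §5.1.1 (5.4)–(5.5) pp. 1089–1090] -/
noncomputable def twRowC2 (m J : ℕ) (Q : ℕ → ℤ) (a N : ℕ) : ℂ :=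
  ∑ j ∈ range (J + 1), ∑ s ∈ range (a + 1), (epsN j : ℂ) * Complex.I ^ j * (Q j : ℂ)
    * ((a.choose s : ℕ) : ℂ) * (SrwCount.walk1 N ((cosOrd m a j s : ℕ) : ℤ) : ℂ)

/-- **The formal class EGF** `G_a(s) = Σ_N φ_a(N) s^N / N!`. [cite: FitznerVanDerHofstad2016NoBLE, §5.1.1 (5.4)–(5.5) pp. 1089–1090] -/
noncomputable def twG2 (m J : ℕ) (Q : ℕ → ℤ) (a : ℕ) : PowerSeries ℂ :=
  PowerSeries.mk fun N => twRowC2 m J Q a N / (N ! : ℂ)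

/-- Real part of `φ_a(N)`. [cite: FitznerVanDerHofstad2016NoBLE, §5.1.1 (5.4)–(5.5) pp. 1089–1090] -/
theorem twRowC2_re (m J : ℕ) (Q : ℕ → ℤ) (a N : ℕ) :
    (twRowC2 m J Q a N).re = ∑ j ∈ range (J + 1), ∑ s ∈ range (a + 1),
      (epsN j : ℝ) * (reSign j : ℝ) * (Q j : ℝ) * ((a.choose s : ℕ) : ℝ)
        * (SrwCount.walk1 N ((cosOrd m a j s : ℕ) : ℤ) : ℝ) := by
  rw [twRowC2, Complex.re_sum]
  refine sum_congr rfl fun j _ => ?_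
  rw [Complex.re_sum]
  refine sum_congr rfl fun s _ => ?_
  rw [I_pow_eq]
  simp

/-- Imaginary part of `φ_a(N)`. [cite: FitznerVanDerHofstad2016NoBLE, §5.1.1 (5.4)–(5.5) pp. 1089–1090] -/
theorem twRowC2_im (m J : ℕ) (Q : ℕ → ℤ) (a N : ℕ) :
    (twRowC2 m J Q a N).im = ∑ j ∈ range (J + 1), ∑ s ∈ range (a + 1),
      (epsN j : ℝ) * (imSign j : ℝ) * (Q j : ℝ) * ((a.choose s : ℕ) : ℝ)
        * (SrwCount.walk1 N ((cosOrd m a j s : ℕ) : ℤ) : ℝ) := by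
  rw [twRowC2, Complex.im_sum]
  refine sum_congr rfl fun j _ => ?_
  rw [Complex.im_sum]
  refine sum_congr rfl fun s _ => ?_
  rw [I_pow_eq]
  simp

/-- Coefficients of `twG2`. [cite: FitznerVanDerHofstad2016NoBLE, §5.1.1 (5.4)–(5.5) pp. 1089–1090] -/
theorem coeff_twG2 (m J : ℕ) (Q : ℕ → ℤ) (a N : ℕ) :
    PowerSeries.coeff N (twG2 m J Q a) = twRowC2 m J Q a N / (N ! : ℂ) := by
  rw [twG2, PowerSeries.coeff_mk]

/-- The parity of the class-row orders: `|jm + a - 2s| ≡ jm + a (mod 2)`. [cite: FitznerVanDerHofstad2016NoBLE, §5.1.1 (5.4)–(5.5) pp. 1089–1090] -/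
theorem cosOrd_mod_two (m a j s : ℕ) : cosOrd m a j s % 2 = (j * m + a) % 2 := by
  unfold cosOrd; split_ifs <;> omega

/-- `|(jm + a : ℤ) - 2s| = cosOrd`. [cite: FitznerVanDerHofstad2016NoBLE, §5.1.1 (5.4)–(5.5) pp. 1089–1090] -/
theorem natAbs_sub_eq_cosOrd (m a j s : ℕ) :
    (((j * m + a : ℕ) : ℤ) - 2 * (s : ℤ)).natAbs = cosOrd m a j s := by
  unfold cosOrd; split_ifs with h <;> omega

/-- **`twG2 a` has the parity pair `(a mod 2, (a+m) mod 2)`.** [cite: FitznerVanDerHofstad2016NoBLE, §5.1.1 (5.4)–(5.5) pp. 1089–1090] -/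
theorem parityC2_twG2 (m J : ℕ) (Q : ℕ → ℤ) (a : ℕ) : ParityC2 (a % 2) ((a + m) % 2) (twG2 m J Q a) := by
  constructor
  · intro N hN
    rw [coeff_twG2, ← Complex.ofReal_natCast, Complex.div_ofReal_re, twRowC2_re]
    rw [sum_eq_zero, zero_div]
    intro j _
    refine sum_eq_zero fun s _ => ?_
    by_cases hj : j % 2 = 0
    · have hjm : (j * m) % 2 = 0 := by rw [Nat.mul_mod, hj, zero_mul, Nat.zero_mod]
      have hb := cosOrd_mod_two m a j s
      rw [walk1_eq_zero_of_parity N (cosOrd m a j s) (by omega)]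
      simp
    · simp [reSign, hj]
  · intro N hN
    rw [coeff_twG2, ← Complex.ofReal_natCast, Complex.div_ofReal_im, twRowC2_im]
    rw [sum_eq_zero, zero_div]
    intro j _
    refine sum_eq_zero fun s _ => ?_
    by_cases hj : j % 2 = 0
    · simp [imSign, hj]
    · have hjm : (j * m) % 2 = m % 2 := by
        rw [Nat.mul_mod, show j % 2 = 1 by omega, one_mul, Nat.mod_mod]
      have hb := cosOrd_mod_two m a j s
      rw [walk1_eq_zero_of_parity N (cosOrd m a j s) (by omega)]
      simp

/-- **`twG2 a` has Gaussian-integer numerators.** [cite: FitznerVanDerHofstad2016NoBLE, §5.1.1 (5.4)–(5.5) pp. 1089–1090] -/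
theorem intC_twG2 (m J : ℕ) (Q : ℕ → ℤ) (a : ℕ) : IntC (twG2 m J Q a) := by
  intro N
  have hN : (N ! : ℂ) ≠ 0 := by exact_mod_cast (Nat.factorial_pos N).ne'
  rw [coeff_twG2, mul_div_cancel₀ _ hN]
  refine ⟨∑ j ∈ range (J + 1), ∑ s ∈ range (a + 1), (epsN j : ℤ) * reSign j * Q j * (a.choose s : ℕ)
      * (SrwCount.walk1 N ((cosOrd m a j s : ℕ) : ℤ) : ℤ),
    ∑ j ∈ range (J + 1), ∑ s ∈ range (a + 1), (epsN j : ℤ) * imSign j * Q j * (a.choose s : ℕ)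
      * (SrwCount.walk1 N ((cosOrd m a j s : ℕ) : ℤ) : ℤ), ?_⟩
  apply Complex.ext
  · rw [twRowC2_re]
    simp only [Complex.add_re, Complex.mul_re, Complex.intCast_re, Complex.intCast_im, Complex.I_re,
      Complex.I_im, mul_zero, sub_zero, zero_mul, add_zero]
    push_cast
    rfl
  · rw [twRowC2_im]
    simp only [Complex.add_im, Complex.mul_im, Complex.intCast_re, Complex.intCast_im, Complex.I_re,
      Complex.I_im, mul_one, zero_add, zero_mul, add_zero]
    push_cast
    rfl

/-- The class-row weight as `(ε_j C(a,s)) · |Q_j|`. [cite: FitznerVanDerHofstad2016NoBLE, §5.1.1 (5.4)–(5.5) pp. 1089–1090] -/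
theorem cosW_eq (a : ℕ) (Q : ℕ → ℤ) (j s : ℕ) : cosW a Q j s = epsN j * a.choose s * (Q j).natAbs := by
  unfold cosW epsN; ring

/-- Real part of `rowTermGZ2 j s`: present iff `j` is even. [cite: FitznerVanDerHofstad2016NoBLE, §5.1.1 (5.4)–(5.5) pp. 1089–1090] -/
theorem zval_rowTermGZ2_re (Mf K ρ σ m a : ℕ) (Q : ℕ → ℤ) (j s k : ℕ) :
    zval (rowTermGZ2 Mf K ρ σ m a Q j s).1 k = if j % 2 = 0 then
      rtSign Q j * ((rowTerm Mf K (cosOrd m a j s) ((cosOrd m a j s - ρ) / 2) (cosW a Q j s)).getD k 0 : ℤ)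
      else 0 := by
  unfold rowTermGZ2
  by_cases hj : j % 2 = 0
  · simp only [hj, if_true]
    exact zval_bif _ _ _ (getD_replicate_zero (K + 1)) k
  · simp only [hj, if_false, zval, getD_replicate_zero]
    simp

/-- Imaginary part of `rowTermGZ2 j s`: present iff `j` is odd. [cite: FitznerVanDerHofstad2016NoBLE, §5.1.1 (5.4)–(5.5) pp. 1089–1090] -/
theorem zval_rowTermGZ2_im (Mf K ρ σ m a : ℕ) (Q : ℕ → ℤ) (j s k : ℕ) :
    zval (rowTermGZ2 Mf K ρ σ m a Q j s).2 k = if j % 2 = 0 then 0 else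
      rtSign Q j * ((rowTerm Mf K (cosOrd m a j s) ((cosOrd m a j s - σ) / 2) (cosW a Q j s)).getD k 0 : ℤ) := by
  unfold rowTermGZ2
  by_cases hj : j % 2 = 0
  · simp only [hj, if_true, zval, getD_replicate_zero]
    simp
  · simp only [hj, if_false]
    exact zval_bif _ _ _ (getD_replicate_zero (K + 1)) k

/-- All parts of `rowTermGZ2 j s` have length `K+1`. [cite: FitznerVanDerHofstad2016NoBLE, §5.1.1 (5.4)–(5.5) pp. 1089–1090] -/
theorem rowTermGZ2_len (Mf K ρ σ m a : ℕ) (Q : ℕ → ℤ) (j s : ℕ) :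
    GZlen (rowTermGZ2 Mf K ρ σ m a Q j s) (K + 1) := by
  unfold rowTermGZ2 GZlen
  simp only []
  split_ifs <;> cases (xor (decide (Q j < 0)) (decide (2 ≤ j % 4))) <;>
    simp [length_rowTerm]

/-- **The class row `Θ_1^{(a)}` is the class EGF row**: `TwInv2` for `gzRow2` against `twG2 a`
(`M̂ = 2K+1`). [cite: FitznerVanDerHofstad2016NoBLE, §5.1.1 (5.4)–(5.5) pp. 1089–1090] -/
theorem twInv2_gzRow2 (Mh K m J a : ℕ) (Q : ℕ → ℤ) (hMh : Mh = 2 * K + 1) :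
    TwInv2 Mh K (a % 2) ((a + m) % 2) (twG2 m J Q a) (gzRow2 (Mh !) K (a % 2) ((a + m) % 2) m a J Q) := by
  have hρ2 : a % 2 < 2 := Nat.mod_lt _ two_pos
  have hσ2 : (a + m) % 2 < 2 := Nat.mod_lt _ two_pos
  have hlen : GZlen (gzSum (fun i => rowTermGZ2 (Mh !) K (a % 2) ((a + m) % 2) m a Q (i / (a + 1))
      (i % (a + 1))) ((J + 1) * (a + 1)) (zeroPN (K + 1), zeroPN (K + 1))) (K + 1) :=
    gzSum_len _ (K + 1) (fun i => rowTermGZ2_len (Mh !) K _ _ m a Q _ _) _ _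
      ⟨by simp [zeroPN], by simp [zeroPN], by simp [zeroPN], by simp [zeroPN]⟩
  have hzv1 : ∀ k, zval (zeroPN (K + 1), zeroPN (K + 1)).1 k = 0 := fun k => by simp [zval, zeroPN]
  have hzv2 : ∀ k, zval (zeroPN (K + 1), zeroPN (K + 1)).2 k = 0 := fun k => by simp [zval, zeroPN]
  refine ⟨?_, ?_, ?_⟩
  · obtain ⟨h1, h2, h3, h4⟩ := hlen
    refine ⟨?_, ?_, ?_, ?_⟩ <;>
      simp only [gzRow2, forcePN_eq, (length_normPN _).1, (length_normPN _).2, h1, h2, h3, h4, max_self]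
  · intro k hk
    rw [coeff_twG2, ← Complex.ofReal_natCast, Complex.div_ofReal_re, twRowC2_re]
    simp only [gzRow2, forcePN_eq]
    rw [zval_normPN, (zval_gzSum _ k _ _).1, hzv1, zero_add, Int.cast_sum]
    rw [sum_flat (fun j s => ((zval (rowTermGZ2 (Mh !) K (a % 2) ((a + m) % 2) m a Q j s).1 k : ℤ) : ℝ))
      a (J + 1), sum_div, mul_sum]
    refine sum_congr rfl fun j _ => ?_
    rw [sum_div, mul_sum]
    refine sum_congr rfl fun s _ => ?_
    rw [zval_rowTermGZ2_re]
    by_cases hj : j % 2 = 0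
    · have hjm : (j * m) % 2 = 0 := by rw [Nat.mul_mod, hj, zero_mul, Nat.zero_mod]
      have hb := cosOrd_mod_two m a j s
      have ha : cosOrd m a j s = 2 * ((cosOrd m a j s - a % 2) / 2) + a % 2 := by omega
      have hE := hat_real Mh (cosOrd m a j s) ((cosOrd m a j s - a % 2) / 2) (a % 2) k ha (by omega)
      rw [if_pos hj, getD_rowTerm _ _ _ _ _ _ hk, cosW_eq, Nat.cast_mul, ← mul_assoc, rtSign_mul_cabs,
        reSign_of_even hj, Int.cast_mul, Int.cast_natCast, hE]
      push_cast
      ring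
    · rw [if_neg hj]
      simp [reSign, hj]
  · intro k hk
    rw [coeff_twG2, ← Complex.ofReal_natCast, Complex.div_ofReal_im, twRowC2_im]
    simp only [gzRow2, forcePN_eq]
    rw [zval_normPN, (zval_gzSum _ k _ _).2, hzv2, zero_add, Int.cast_sum]
    rw [sum_flat (fun j s => ((zval (rowTermGZ2 (Mh !) K (a % 2) ((a + m) % 2) m a Q j s).2 k : ℤ) : ℝ))
      a (J + 1), sum_div, mul_sum]
    refine sum_congr rfl fun j _ => ?_
    rw [sum_div, mul_sum]
    refine sum_congr rfl fun s _ => ?_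
    rw [zval_rowTermGZ2_im]
    by_cases hj : j % 2 = 0
    · rw [if_pos hj]
      simp [imSign, hj]
    · have hjm : (j * m) % 2 = m % 2 := by
        rw [Nat.mul_mod, show j % 2 = 1 by omega, one_mul, Nat.mod_mod]
      have hb := cosOrd_mod_two m a j s
      have ha : cosOrd m a j s = 2 * ((cosOrd m a j s - (a + m) % 2) / 2) + (a + m) % 2 := by omega
      have hE := hat_real Mh (cosOrd m a j s) ((cosOrd m a j s - (a + m) % 2) / 2) ((a + m) % 2) k ha
        (by omega)
      rw [if_neg hj, getD_rowTerm _ _ _ _ _ _ hk, cosW_eq, Nat.cast_mul, ← mul_assoc, rtSign_mul_cabs,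
        imSign_of_odd hj, Int.cast_mul, Int.cast_natCast, hE]
      push_cast
      ring


/-! ## Part 4. Classes, the product table, and the Horner sums -/

/-- **The formal product EGF** `F = ∏_r G_{a_r}^{p_r}` of a class list (right-nested).
[cite: FitznerVanDerHofstad2016NoBLE, §5.1.1 (5.4)–(5.5) pp. 1089–1090] -/
noncomputable def prF (m J : ℕ) (Q : ℕ → ℤ) : List (ℕ × ℕ) → PowerSeries ℂ
  | [] => 1
  | (a, p) :: t => twG2 m J Q a ^ p * prF m J Q t

/-- The class table `gzClass a p` is `Θ(G_a^p)` with the pair `(rhoP, sigP)` (`1 ≤ p`).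
[cite: FitznerVanDerHofstad2016NoBLE, §5.1.1 (5.4)–(5.5) pp. 1089–1090] -/
theorem twInv2_gzClass {Mh K : ℕ} (m J : ℕ) (Q : ℕ → ℤ) (hMh : Mh = 2 * K + 1) (a p : ℕ) (hp : 1 ≤ p) :
    TwInv2 Mh K (rhoP (a % 2) p) (sigP (a % 2) ((a + m) % 2) p) (twG2 m J Q a ^ p)
      (gzClass (Mh !) K m J Q a p) :=
  twInv2_gzPow2 hMh (Nat.mod_lt _ two_pos) (Nat.mod_lt _ two_pos) (parityC2_twG2 m J Q a)
    (intC_twG2 m J Q a) (twInv2_gzRow2 Mh K m J a Q hMh) p hp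

/-- **The fold invariant of `gzProdAux`**: from `Θ(F₀)` with a pair `(ρ,σ)` consistent with `m`
(`ρ + σ ≡ m`), the fold over `t` returns `Θ(F₀ · prF t)` together with ITS pair.
[cite: FitznerVanDerHofstad2016NoBLE, §5.1.1 (5.4)–(5.5) pp. 1089–1090] -/
theorem twInv2_gzProdAux {Mh K : ℕ} (m J : ℕ) (Q : ℕ → ℤ) (hMh : Mh = 2 * K + 1) :
    ∀ (t : List (ℕ × ℕ)) (acc : GZ) (ρ σ : ℕ) (F : PowerSeries ℂ), ρ < 2 → σ < 2 →
      (ρ + σ) % 2 = m % 2 → ParityC2 ρ σ F → IntC F → TwInv2 Mh K ρ σ F acc → (∀ ap ∈ t, 1 ≤ ap.2) →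
      TwInv2 Mh K (gzProdAux (Mh !) K m J Q acc ρ σ t).2.1 (gzProdAux (Mh !) K m J Q acc ρ σ t).2.2
          (F * prF m J Q t) (gzProdAux (Mh !) K m J Q acc ρ σ t).1
        ∧ ParityC2 (gzProdAux (Mh !) K m J Q acc ρ σ t).2.1 (gzProdAux (Mh !) K m J Q acc ρ σ t).2.2
          (F * prF m J Q t)
        ∧ IntC (F * prF m J Q t)
  | [], acc, ρ, σ, F, _, _, _, hpar, hint, hinv, _ => by
      simp only [gzProdAux, prF, mul_one]; exact ⟨hinv, hpar, hint⟩
  | (a, p) :: t, acc, ρ, σ, F, hρ, hσ, hc, hpar, hint, hinv, hps => by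
      have hp1 : 1 ≤ p := hps (a, p) (List.mem_cons_self)
      have hρa : a % 2 < 2 := Nat.mod_lt _ two_pos
      have hparG := parityC2_twG2 m J Q a
      have hintG := intC_twG2 m J Q a
      have hcls := twInv2_gzClass m J Q hMh a p hp1
      have hcc : (rhoP (a % 2) p + sigP (a % 2) ((a + m) % 2) p) % 2 = m % 2 := by
        rw [rhoP_add_sigP hρa]; omega
      have hmul := twInv2_gzMulP hMh hρ hσ (rhoP_lt _ _) (sigP_lt _ _ _) (hc.trans hcc.symm) hpar
        hint (intC_pow hintG p) hinv hcls
      have hpar' := parityC2_mul (hc.trans hcc.symm) hpar (parityC2_pow hρa hparG p)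
      have hrec := twInv2_gzProdAux m J Q hMh t _ _ _ _ (Nat.mod_lt _ two_pos) (Nat.mod_lt _ two_pos)
        (by omega) hpar' (intC_mul hint (intC_pow hintG p)) hmul
        (fun ap hap => hps ap (List.mem_cons_of_mem _ hap))
      simp only [gzProdAux, prF, ← mul_assoc]
      exact hrec

/-- The first class and the fold: `gzProd ((a,p) :: t)`. [cite: FitznerVanDerHofstad2016NoBLE, §5.1.1 (5.4)–(5.5) pp. 1089–1090] -/
theorem twInv2_gzProd_cons {Mh K : ℕ} (m J : ℕ) (Q : ℕ → ℤ) (hMh : Mh = 2 * K + 1) (a p : ℕ)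
    (t : List (ℕ × ℕ)) (hps : ∀ ap ∈ (a, p) :: t, 1 ≤ ap.2) :
    TwInv2 Mh K (gzProd (Mh !) K m J Q ((a, p) :: t)).2.1 (gzProd (Mh !) K m J Q ((a, p) :: t)).2.2
        (prF m J Q ((a, p) :: t)) (gzProd (Mh !) K m J Q ((a, p) :: t)).1
      ∧ ParityC2 (gzProd (Mh !) K m J Q ((a, p) :: t)).2.1 (gzProd (Mh !) K m J Q ((a, p) :: t)).2.2
        (prF m J Q ((a, p) :: t))
      ∧ IntC (prF m J Q ((a, p) :: t)) := by
  have hp1 : 1 ≤ p := hps (a, p) (List.mem_cons_self)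
  have hρa : a % 2 < 2 := Nat.mod_lt _ two_pos
  have hcc : (rhoP (a % 2) p + sigP (a % 2) ((a + m) % 2) p) % 2 = m % 2 := by
    rw [rhoP_add_sigP hρa]; omega
  simp only [gzProd, prF]
  exact twInv2_gzProdAux m J Q hMh t _ _ _ _ (rhoP_lt _ _) (sigP_lt _ _ _) hcc
    (parityC2_pow hρa (parityC2_twG2 m J Q a) p) (intC_pow (intC_twG2 m J Q a) p)
    (twInv2_gzClass m J Q hMh a p hp1) (fun ap hap => hps ap (List.mem_cons_of_mem _ hap))

/-- `IntC` of the product EGF. [cite: FitznerVanDerHofstad2016NoBLE, §5.1.1 (5.4)–(5.5) pp. 1089–1090] -/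
theorem intC_prF (m J : ℕ) (Q : ℕ → ℤ) : ∀ cls : List (ℕ × ℕ), IntC (prF m J Q cls)
  | [] => intC_one
  | (a, p) :: t => intC_mul (intC_pow (intC_twG2 m J Q a) p) (intC_prF m J Q t)

namespace PrCert

variable (c : PrCert) (D : ℕ)

/-- **The certificate's table is `Θ(F)`**, `F = prF cls`, with its parity pair (non-empty class list,
positive multiplicities; `Mf = prodRange 0 M̂ = M̂!`). [cite: FitznerVanDerHofstad2016NoBLE, §5.1.1 (5.4)–(5.5) pp. 1089–1090] -/
theorem tableP_spec (hne : c.cls ≠ []) (hps : ∀ ap ∈ c.cls, 1 ≤ ap.2) :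
    TwInv2 c.Mh c.K c.tableP.2.1 c.tableP.2.2 (prF c.m c.J c.Q c.cls) c.tableP.1
      ∧ ParityC2 c.tableP.2.1 c.tableP.2.2 (prF c.m c.J c.Q c.cls) := by
  obtain ⟨⟨a, p⟩, t, hct⟩ := List.exists_cons_of_ne_nil hne
  have h := twInv2_gzProd_cons c.m c.J c.Q (Mh := c.Mh) (K := c.K) rfl a p t (hct ▸ hps)
  rw [PrCert.tableP, prodRange_zero, hct]
  exact ⟨h.1, h.2.1⟩

/-- The real form of `2^{Σpa}`. [cite: FitznerVanDerHofstad2016NoBLE, §5.1.1 (5.4)–(5.5) pp. 1089–1090] -/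
theorem cast_twoA : ((c.twoA : ℚ) : ℝ) = (2 : ℝ) ^ c.asum := by
  rw [PrCert.twoA]; push_cast; rfl

/-- **`P_n` in `ℝ` against a formal series**: if the list `re` holds `M̂!·Re[s^{2i}]F` (`i ≤ K`), then
`PqP re n = Σ_{i<cnt n} C(2i+n', n') · (2i)! Re [s^{2i}] F / ((2D)^{2i} qden^D 2^{Σpa})`.
[cite: FitznerVanDerHofstad2016NoBLE, §5.1.1 (5.4)–(5.5) pp. 1089–1090] -/
theorem PqP_real {F : PowerSeries ℂ} {re : List ℕ × List ℕ}
    (hre : ∀ i, i ≤ c.K → (zval re i : ℝ) = (c.Mh ! : ℝ) * (PowerSeries.coeff (2 * i) F).re)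
    (hl1 : re.1.length = c.K + 1) (hl2 : re.2.length = c.K + 1)
    (n : ℕ) (hK : c.cnt n ≤ c.K + 1) (hD : 1 ≤ D) (hq : 0 < c.qden) :
    ((c.PqP D re n : ℚ) : ℝ) = ∑ i ∈ range (c.cnt n),
      (((2 * i + (n - 1)).choose (n - 1) : ℕ) : ℝ) * (((2 * i)! : ℝ)
        * (PowerSeries.coeff (2 * i) F).re)
        / ((((2 * D : ℕ) : ℝ)) ^ (2 * i) * ((c.qden : ℝ) ^ D * (2 : ℝ) ^ c.asum)) := by
  have h1 : c.cnt n ≤ re.1.length := by rw [hl1]; exact hK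
  have h2 : c.cnt n ≤ re.2.length := by rw [hl2]; exact hK
  rw [PrCert.PqP, Rat.cast_div, cast_twoA, c.PqT_eq D _ n h1 h2 hK hD hq]
  push_cast
  rw [sum_div]
  refine sum_congr rfl fun i hi => ?_
  rw [mem_range] at hi
  rw [hre i (by omega)]
  have hch : (((2 * i + (n - 1)).choose (n - 1) : ℕ) : ℝ)
      = ((2 * i + (n - 1))! : ℝ) / (((2 * i)! : ℝ) * ((n - 1)! : ℝ)) := by
    rw [eq_div_iff (by positivity), ← mul_assoc]
    exact_mod_cast Nat.add_choose_mul_factorial_mul_factorial (2 * i) (n - 1)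
  rw [hch, show (n - 1) + 2 * i = 2 * i + (n - 1) by ring]
  have hf1 : (((2 * i))! : ℝ) ≠ 0 := by positivity
  have hf2 : (((n - 1))! : ℝ) ≠ 0 := by positivity
  have hf3 : ((c.Mh)! : ℝ) ≠ 0 := by positivity
  have hD0 : (((2 * D : ℕ) : ℝ)) ^ (2 * i) ≠ 0 := by positivity
  have hq' : (c.qden : ℝ) ^ D ≠ 0 := by positivity
  have h2A : (2 : ℝ) ^ c.asum ≠ 0 := by positivity
  field_simp

/-- **`U_n` in `ℝ` against a formal series** (as `PqP_real`, with the factor `E_{2i+n'+1}(λ)`).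
[cite: FitznerVanDerHofstad2016NoBLE, §5.1.1 (5.4)–(5.5) pp. 1089–1090] -/
theorem UqP_real {F : PowerSeries ℂ} {re : List ℕ × List ℕ}
    (hre : ∀ i, i ≤ c.K → (zval re i : ℝ) = (c.Mh ! : ℝ) * (PowerSeries.coeff (2 * i) F).re)
    (hl1 : re.1.length = c.K + 1) (hl2 : re.2.length = c.K + 1)
    (n : ℕ) (hK : c.cnt n ≤ c.K + 1) (hD : 1 ≤ D) (hq : 0 < c.qden) :
    ((c.UqP D re n : ℚ) : ℝ) = ∑ i ∈ range (c.cnt n),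
      (((2 * i + (n - 1)).choose (n - 1) : ℕ) : ℝ) * (((2 * i)! : ℝ)
        * (PowerSeries.coeff (2 * i) F).re)
        / ((((2 * D : ℕ) : ℝ)) ^ (2 * i) * ((c.qden : ℝ) ^ D * (2 : ℝ) ^ c.asum))
        * ((EQ (c.lamT D) (2 * i + (n - 1) + 1) : ℚ) : ℝ) := by
  have h1 : c.cnt n ≤ re.1.length := by rw [hl1]; exact hK
  have h2 : c.cnt n ≤ re.2.length := by rw [hl2]; exact hK
  rw [PrCert.UqP, Rat.cast_div, cast_twoA, c.UqT_eq D _ n h1 h2 hK hD hq]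
  push_cast
  rw [sum_div]
  refine sum_congr rfl fun i hi => ?_
  rw [mem_range] at hi
  rw [hre i (by omega)]
  have hch : (((2 * i + (n - 1)).choose (n - 1) : ℕ) : ℝ)
      = ((2 * i + (n - 1))! : ℝ) / (((2 * i)! : ℝ) * ((n - 1)! : ℝ)) := by
    rw [eq_div_iff (by positivity), ← mul_assoc]
    exact_mod_cast Nat.add_choose_mul_factorial_mul_factorial (2 * i) (n - 1)
  rw [hch, show (n - 1) + 2 * i = 2 * i + (n - 1) by ring]
  have hf1 : (((2 * i))! : ℝ) ≠ 0 := by positivity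
  have hf2 : (((n - 1))! : ℝ) ≠ 0 := by positivity
  have hf3 : ((c.Mh)! : ℝ) ≠ 0 := by positivity
  have hD0 : (((2 * D : ℕ) : ℝ)) ^ (2 * i) ≠ 0 := by positivity
  have hq' : (c.qden : ℝ) ^ D ≠ 0 := by positivity
  have h2A : (2 : ℝ) ^ c.asum ≠ 0 := by positivity
  field_simp

end PrCert


/-! ## Part 5. The size of the coefficients: `‖N!·[s^N] F‖ ≤ q^{Σp} 2^{Σpa} (2Σp)^N` -/

/-- `ε_j x = x + [j ≠ 0] x`. [cite: FitznerVanDerHofstad2016NoBLE, §5.1.1 (5.4)–(5.5) pp. 1089–1090] -/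
theorem epsN_mul (j x : ℕ) : epsN j * x = x + (if j = 0 then 0 else x) := by
  unfold epsN; split_ifs <;> ring

/-- Unfolding the `ε_j`-weighted sum: `Σ_{j ≤ J} ε_j X_j = Σ_{j ≤ J} X_j + Σ_{j < J} X_{j+1}`.
[cite: FitznerVanDerHofstad2016NoBLE, §5.1.1 (5.4)–(5.5) pp. 1089–1090] -/
theorem sum_epsN_mul (J : ℕ) (X : ℕ → ℕ) :
    ∑ j ∈ range (J + 1), epsN j * X j = ∑ j ∈ range (J + 1), X j + ∑ j ∈ range J, X (j + 1) := by
  simp only [epsN_mul, sum_add_distrib]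
  congr 1
  rw [sum_range_succ']
  simp

/-- **At most `2^N` walks end in the `2J+1` distinct sites** `c + jm` (`0 ≤ j ≤ J`) and `c - (j+1)m`
(`j < J`), `m > 0`. [cite: FitznerVanDerHofstad2016NoBLE, §5.1.1 (5.4)–(5.5) pp. 1089–1090] -/
theorem sum_walk1_two_ranges_le (N m J : ℕ) (hm : 0 < m) (c : ℤ) :
    ∑ j ∈ range (J + 1), SrwCount.walk1 N ((j : ℤ) * m + c)
      + ∑ j ∈ range J, SrwCount.walk1 N (-(((j + 1 : ℕ) : ℤ) * m) + c) ≤ 2 ^ N := by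
  have hm' : (0 : ℤ) < m := by exact_mod_cast hm
  have hinj1 : Set.InjOn (fun j : ℕ => (j : ℤ) * m + c) (range (J + 1) : Finset ℕ) := by
    intro x _ y _ h
    have h' : (x : ℤ) * m = (y : ℤ) * m := by
      have := h; simp only at this; linarith
    exact_mod_cast mul_right_cancel₀ hm'.ne' h'
  have hinj2 : Set.InjOn (fun j : ℕ => -(((j + 1 : ℕ) : ℤ) * m) + c) (range J : Finset ℕ) := by
    intro x _ y _ h
    have h' : ((x + 1 : ℕ) : ℤ) * m = ((y + 1 : ℕ) : ℤ) * m := by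
      have := h; simp only at this; linarith
    have h'' := mul_right_cancel₀ hm'.ne' h'
    push_cast at h''
    exact_mod_cast (by linarith : (x : ℤ) = y)
  have hdisj : Disjoint ((range (J + 1)).image (fun j : ℕ => (j : ℤ) * m + c))
      ((range J).image (fun j : ℕ => -(((j + 1 : ℕ) : ℤ) * m) + c)) := by
    rw [Finset.disjoint_left]
    intro z hz1 hz2
    rw [mem_image] at hz1 hz2
    obtain ⟨x, _, rfl⟩ := hz1
    obtain ⟨y, _, hy⟩ := hz2
    have hpos : (0 : ℤ) < ((x : ℤ) + ((y + 1 : ℕ) : ℤ)) * m := mul_pos (by positivity) hm'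
    have : ((x : ℤ) + ((y + 1 : ℕ) : ℤ)) * m = 0 := by linarith
    linarith
  have h := sum_walk1_le_two_pow N (((range (J + 1)).image (fun j : ℕ => (j : ℤ) * m + c))
    ∪ ((range J).image (fun j : ℕ => -(((j + 1 : ℕ) : ℤ) * m) + c)))
  rw [sum_union hdisj, sum_image hinj1, sum_image hinj2] at h
  exact h

/-- The class-row order as a signed site: `walk1(N, |jm+a-2s|) = walk1(N, jm + (a - 2s))`.
[cite: FitznerVanDerHofstad2016NoBLE, §5.1.1 (5.4)–(5.5) pp. 1089–1090] -/
theorem walk1_cosOrd (N m a j s : ℕ) :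
    SrwCount.walk1 N ((cosOrd m a j s : ℕ) : ℤ) = SrwCount.walk1 N ((j : ℤ) * m + ((a : ℤ) - 2 * s)) := by
  rw [SrwCount.walk1_natAbs N ((j : ℤ) * m + ((a : ℤ) - 2 * s)), ← natAbs_sub_eq_cosOrd m a j s]
  have hAB : (((j * m + a : ℕ) : ℤ) - 2 * (s : ℤ)) = (j : ℤ) * m + ((a : ℤ) - 2 * s) := by
    push_cast; ring
  rw [hAB]

/-- **The class row counts at most `2^a · 2^N` walks**:
`Σ_{j ≤ J} Σ_{s ≤ a} ε_j C(a,s) walk1(N, |jm+a-2s|) ≤ 2^a 2^N` (fold `j ↔ -j`, `s ↔ a-s`; `m > 0`).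
[cite: FitznerVanDerHofstad2016NoBLE, §5.1.1 (5.4)–(5.5) pp. 1089–1090] -/
theorem sum_eps_choose_walk1_le_two_pow (N m J a : ℕ) (hm : 0 < m) :
    ∑ j ∈ range (J + 1), ∑ s ∈ range (a + 1),
        epsN j * a.choose s * SrwCount.walk1 N ((cosOrd m a j s : ℕ) : ℤ) ≤ 2 ^ a * 2 ^ N := by
  set X : ℕ → ℕ := fun j => ∑ s ∈ range (a + 1),
    a.choose s * SrwCount.walk1 N ((j : ℤ) * m + ((a : ℤ) - 2 * s)) with hX
  have hstep1 : ∑ j ∈ range (J + 1), ∑ s ∈ range (a + 1),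
      epsN j * a.choose s * SrwCount.walk1 N ((cosOrd m a j s : ℕ) : ℤ)
      = ∑ j ∈ range (J + 1), epsN j * X j := by
    refine sum_congr rfl fun j _ => ?_
    rw [hX, mul_sum]
    refine sum_congr rfl fun s _ => ?_
    rw [walk1_cosOrd, mul_assoc]
  have hrefl : ∀ j : ℕ, X j = ∑ s ∈ range (a + 1),
      a.choose s * SrwCount.walk1 N (-((j : ℤ) * m) + ((a : ℤ) - 2 * s)) := by
    intro j
    rw [hX]
    conv_rhs => rw [← sum_range_reflect]
    refine sum_congr rfl fun s hs => ?_
    rw [mem_range] at hs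
    have hs' : s ≤ a := by omega
    rw [show a + 1 - 1 - s = a - s by omega, Nat.choose_symm hs']
    congr 1
    rw [← SrwCount.walk1_neg]
    congr 1
    push_cast [Nat.cast_sub hs']
    ring
  have hsplit : ∑ j ∈ range (J + 1), X j + ∑ j ∈ range J, X (j + 1)
      = ∑ s ∈ range (a + 1), a.choose s
        * (∑ j ∈ range (J + 1), SrwCount.walk1 N ((j : ℤ) * m + ((a : ℤ) - 2 * s))
          + ∑ j ∈ range J, SrwCount.walk1 N (-(((j + 1 : ℕ) : ℤ) * m) + ((a : ℤ) - 2 * s))) := by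
    rw [show ∑ j ∈ range J, X (j + 1) = ∑ j ∈ range J, ∑ s ∈ range (a + 1),
        a.choose s * SrwCount.walk1 N (-(((j + 1 : ℕ) : ℤ) * m) + ((a : ℤ) - 2 * s))
        from sum_congr rfl fun j _ => hrefl (j + 1)]
    simp only [hX]
    rw [sum_comm, sum_comm (s := range J), ← sum_add_distrib]
    refine sum_congr rfl fun s _ => ?_
    rw [mul_add, mul_sum, mul_sum]
  rw [hstep1, sum_epsN_mul, hsplit, ← Nat.sum_range_choose a, sum_mul]
  refine sum_le_sum fun s _ => ?_
  exact Nat.mul_le_mul_left _ (sum_walk1_two_ranges_le N m J hm _)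

/-- **Size of the class-row numerators**: `‖φ_a(N)‖ ≤ q 2^a 2^N` (`|Q_j| ≤ q`, `m > 0`).
[cite: FitznerVanDerHofstad2016NoBLE, §5.1.1 (5.4)–(5.5) pp. 1089–1090] -/
theorem norm_twRowC2_le (m J : ℕ) (Q : ℕ → ℤ) (q : ℕ) (hm : 0 < m)
    (hQ : ∀ j, j ≤ J → (Q j).natAbs ≤ q) (a N : ℕ) :
    ‖twRowC2 m J Q a N‖ ≤ (q : ℝ) * 2 ^ a * 2 ^ N := by
  unfold twRowC2
  refine (norm_sum_le _ _).trans ?_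
  have hterm : ∀ j ∈ range (J + 1), ‖∑ s ∈ range (a + 1), (epsN j : ℂ) * Complex.I ^ j * (Q j : ℂ)
      * ((a.choose s : ℕ) : ℂ) * (SrwCount.walk1 N ((cosOrd m a j s : ℕ) : ℤ) : ℂ)‖
      ≤ (q : ℝ) * ((∑ s ∈ range (a + 1),
          epsN j * a.choose s * SrwCount.walk1 N ((cosOrd m a j s : ℕ) : ℤ) : ℕ) : ℝ) := by
    intro j hj
    rw [mem_range] at hj
    refine (norm_sum_le _ _).trans ?_
    rw [Nat.cast_sum, mul_sum]
    refine sum_le_sum fun s _ => ?_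
    rw [norm_mul, norm_mul, norm_mul, norm_mul, norm_pow, Complex.norm_I, one_pow, mul_one,
      Complex.norm_natCast, Complex.norm_natCast, Complex.norm_natCast, Complex.norm_intCast]
    have hq : |(Q j : ℝ)| ≤ (q : ℝ) := by
      rw [← Int.cast_abs]
      have := hQ j (by omega)
      have h' : |Q j| ≤ (q : ℤ) := by rw [Int.abs_eq_natAbs]; exact_mod_cast this
      exact_mod_cast h'
    push_cast
    calc (epsN j : ℝ) * |(Q j : ℝ)| * (a.choose s : ℝ) * (SrwCount.walk1 N ((cosOrd m a j s : ℕ) : ℤ) : ℝ)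
        = |(Q j : ℝ)| * ((epsN j : ℝ) * (a.choose s : ℝ)
            * (SrwCount.walk1 N ((cosOrd m a j s : ℕ) : ℤ) : ℝ)) := by ring
      _ ≤ (q : ℝ) * ((epsN j : ℝ) * (a.choose s : ℝ)
            * (SrwCount.walk1 N ((cosOrd m a j s : ℕ) : ℤ) : ℝ)) :=
          mul_le_mul_of_nonneg_right hq (by positivity)
  refine (sum_le_sum hterm).trans ?_
  rw [← mul_sum, ← Nat.cast_sum]
  have h2 := sum_eps_choose_walk1_le_two_pow N m J a hm
  have : ((∑ j ∈ range (J + 1), ∑ s ∈ range (a + 1),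
      epsN j * a.choose s * SrwCount.walk1 N ((cosOrd m a j s : ℕ) : ℤ) : ℕ) : ℝ) ≤ 2 ^ a * 2 ^ N := by
    exact_mod_cast h2
  calc (q : ℝ) * _ ≤ (q : ℝ) * (2 ^ a * 2 ^ N) := mul_le_mul_of_nonneg_left this (Nat.cast_nonneg q)
    _ = (q : ℝ) * 2 ^ a * 2 ^ N := by ring

/-- **The class row is dominated by `q 2^a · e^{2s}`.** [cite: FitznerVanDerHofstad2016NoBLE, §5.1.1 (5.4)–(5.5) pp. 1089–1090] -/
theorem majC_twG2 (m J : ℕ) (Q : ℕ → ℤ) (q : ℕ) (hm : 0 < m) (hQ : ∀ j, j ≤ J → (Q j).natAbs ≤ q)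
    (a : ℕ) : MajC (twG2 m J Q a) (expMaj ((q : ℝ) * 2 ^ a) 2) := by
  intro N
  rw [coeff_twG2, coeff_expMaj, norm_div, Complex.norm_natCast,
    div_le_div_iff_of_pos_right (by positivity)]
  exact norm_twRowC2_le m J Q q hm hQ a N

/-- `1` is dominated by `expMaj 1 0 = 1`. [cite: FitznerVanDerHofstad2016NoBLE, §5.1.1 (5.4)–(5.5) pp. 1089–1090] -/
theorem majC_one_expMaj : MajC (1 : PowerSeries ℂ) (expMaj 1 0) := by
  intro N
  rw [PowerSeries.coeff_one, coeff_expMaj]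
  split_ifs with h
  · subst h; simp
  · simp [zero_pow h]

/-- Products of exponential majorants. [cite: FitznerVanDerHofstad2016NoBLE, §5.1.1 (5.4)–(5.5) pp. 1089–1090] -/
theorem expMaj_mul (q q' a a' : ℝ) : expMaj q a * expMaj q' a' = expMaj (q * q') (a + a') := by
  rw [expMaj, expMaj, expMaj, Algebra.smul_mul_assoc, Algebra.mul_smul_comm, smul_smul,
    PowerSeries.exp_mul_exp_eq_exp_add]

/-- Powers of exponential majorants (`p ≥ 1`). [cite: FitznerVanDerHofstad2016NoBLE, §5.1.1 (5.4)–(5.5) pp. 1089–1090] -/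
theorem expMaj_pow (q a : ℝ) (p : ℕ) (hp : 1 ≤ p) : expMaj q a ^ p = expMaj (q ^ p) ((p : ℝ) * a) := by
  ext N
  rw [coeff_expMaj_pow _ _ _ _ hp, coeff_expMaj]

/-- `Σ_r p_r` of a class list. [cite: FitznerVanDerHofstad2016NoBLE, §5.1.1 (5.4)–(5.5) pp. 1089–1090] -/
def psumL (cls : List (ℕ × ℕ)) : ℕ := (cls.map fun ap => ap.2).sum

/-- `Σ_r p_r a_r` of a class list. [cite: FitznerVanDerHofstad2016NoBLE, §5.1.1 (5.4)–(5.5) pp. 1089–1090] -/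
def asumL (cls : List (ℕ × ℕ)) : ℕ := (cls.map fun ap => ap.2 * ap.1).sum

/-- `psumL` of a cons. [cite: FitznerVanDerHofstad2016NoBLE, §5.1.1 (5.4)–(5.5) pp. 1089–1090] -/
theorem psumL_cons (a p : ℕ) (t : List (ℕ × ℕ)) : psumL ((a, p) :: t) = p + psumL t := by
  simp [psumL]

/-- `asumL` of a cons. [cite: FitznerVanDerHofstad2016NoBLE, §5.1.1 (5.4)–(5.5) pp. 1089–1090] -/
theorem asumL_cons (a p : ℕ) (t : List (ℕ × ℕ)) : asumL ((a, p) :: t) = p * a + asumL t := by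
  simp [asumL]

/-- **The product EGF is dominated** by `q^{Σp} 2^{Σpa} · e^{2(Σp)s}` (positive multiplicities).
[cite: FitznerVanDerHofstad2016NoBLE, §5.1.1 (5.4)–(5.5) pp. 1089–1090] -/
theorem majC_prF (m J : ℕ) (Q : ℕ → ℤ) (q : ℕ) (hm : 0 < m) (hQ : ∀ j, j ≤ J → (Q j).natAbs ≤ q) :
    ∀ cls : List (ℕ × ℕ), (∀ ap ∈ cls, 1 ≤ ap.2) →
      MajC (prF m J Q cls) (expMaj ((q : ℝ) ^ psumL cls * 2 ^ asumL cls) (2 * (psumL cls : ℝ)))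
  | [], _ => by
      simp only [prF, psumL, asumL, List.map_nil, List.sum_nil, pow_zero, mul_one, Nat.cast_zero,
        mul_zero]
      exact majC_one_expMaj
  | (a, p) :: t, hps => by
      have hp : 1 ≤ p := hps (a, p) (List.mem_cons_self)
      have h1 := majC_pow (majC_twG2 m J Q q hm hQ a) p
      rw [expMaj_pow _ _ p hp] at h1
      have h2 := majC_prF m J Q q hm hQ t (fun ap hap => hps ap (List.mem_cons_of_mem _ hap))
      have h := majC_mul h1 h2
      rw [expMaj_mul] at h
      rw [prF, psumL_cons, asumL_cons]
      convert h using 2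
      · ring
      · push_cast; ring

/-- **Size of the product coefficients**: `N!·‖[s^N] F‖ ≤ q^{Σp} 2^{Σpa} (2Σp)^N`.
[cite: FitznerVanDerHofstad2016NoBLE, §5.1.1 (5.4)–(5.5) pp. 1089–1090] -/
theorem norm_coeff_prF_le (m J : ℕ) (Q : ℕ → ℤ) (q : ℕ) (hm : 0 < m)
    (hQ : ∀ j, j ≤ J → (Q j).natAbs ≤ q) (cls : List (ℕ × ℕ)) (hps : ∀ ap ∈ cls, 1 ≤ ap.2) (N : ℕ) :
    (N ! : ℝ) * ‖PowerSeries.coeff N (prF m J Q cls)‖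
      ≤ ((q : ℝ) ^ psumL cls * 2 ^ asumL cls) * (2 * (psumL cls : ℝ)) ^ N := by
  have h := majC_prF m J Q q hm hQ cls hps N
  rw [coeff_expMaj] at h
  have hN : (0 : ℝ) < (N ! : ℝ) := by positivity
  calc (N ! : ℝ) * ‖PowerSeries.coeff N (prF m J Q cls)‖
      ≤ (N ! : ℝ) * ((q : ℝ) ^ psumL cls * 2 ^ asumL cls * (2 * (psumL cls : ℝ)) ^ N / (N ! : ℝ)) :=
        mul_le_mul_of_nonneg_left h hN.le
    _ = ((q : ℝ) ^ psumL cls * 2 ^ asumL cls) * (2 * (psumL cls : ℝ)) ^ N := by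
        field_simp


/-! ## Part 6. The coefficients of `F` sum to `∏_r Φ_{a_r}(s)^{p_r}` -/

section Analytic

open Literature.Probability.LatticeModels (besselI)

/-- **The analytic class row** `Φ_a(s) = Σ_{j ≤ J} Σ_{s' ≤ a} ε_j i^j Q_j C(a,s') I_{|jm+a-2s'|}(2s)`.
[cite: FitznerVanDerHofstad2016NoBLE, §5.1.1 (5.4)–(5.5) pp. 1089–1090] -/
noncomputable def twRowFun2 (m J : ℕ) (Q : ℕ → ℤ) (a : ℕ) (s : ℝ) : ℂ :=
  ∑ j ∈ range (J + 1), ∑ s' ∈ range (a + 1), (epsN j : ℂ) * Complex.I ^ j * (Q j : ℂ)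
    * ((a.choose s' : ℕ) : ℂ) * (besselI ((cosOrd m a j s' : ℕ) : ℤ) (2 * s) : ℂ)

/-- **The analytic product** `∏_r Φ_{a_r}(s)^{p_r}` of a class list (right-nested).
[cite: FitznerVanDerHofstad2016NoBLE, §5.1.1 (5.4)–(5.5) pp. 1089–1090] -/
noncomputable def prFFun (m J : ℕ) (Q : ℕ → ℤ) (s : ℝ) : List (ℕ × ℕ) → ℂ
  | [] => 1
  | (a, p) :: t => twRowFun2 m J Q a s ^ p * prFFun m J Q s t

/-- **The formal class row sums to the analytic class row**: `Σ_N [s^N]G_a · s^N = Φ_a(s)`.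
[cite: FitznerVanDerHofstad2016NoBLE, §5.1.1 (5.4)–(5.5) pp. 1089–1090] -/
theorem hasSum_coeff_twG2 (m J : ℕ) (Q : ℕ → ℤ) (a : ℕ) (s : ℝ) :
    HasSum (fun N => PowerSeries.coeff N (twG2 m J Q a) * (s : ℂ) ^ N) (twRowFun2 m J Q a s) := by
  have hj : ∀ j s' : ℕ, HasSum (fun N : ℕ => (epsN j : ℂ) * Complex.I ^ j * (Q j : ℂ)
      * ((a.choose s' : ℕ) : ℂ)
      * ((SrwCount.walk1 N ((cosOrd m a j s' : ℕ) : ℤ) : ℂ) * (s : ℂ) ^ N / (N ! : ℂ)))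
      ((epsN j : ℂ) * Complex.I ^ j * (Q j : ℂ) * ((a.choose s' : ℕ) : ℂ)
        * (besselI ((cosOrd m a j s' : ℕ) : ℤ) (2 * s) : ℂ)) := by
    intro j s'
    have h := Complex.ofRealCLM.hasSum (SrwCount.hasSum_walk1_egf ((cosOrd m a j s' : ℕ) : ℤ) s)
    simp only [Complex.ofRealCLM_apply] at h
    push_cast at h
    exact h.mul_left _
  have hsum := hasSum_sum (s := range (J + 1))
    (fun j _ => hasSum_sum (s := range (a + 1)) (fun s' _ => hj j s'))
  refine hsum.congr_fun fun N => ?_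
  rw [coeff_twG2, twRowC2, sum_div, sum_mul]
  refine sum_congr rfl fun j _ => ?_
  rw [sum_div, sum_mul]
  refine sum_congr rfl fun s' _ => ?_
  ring

/-- Absolute summability of `[s^N]G · s^N` from an exponential majorant. [cite: FitznerVanDerHofstad2016NoBLE, §5.1.1 (5.4)–(5.5) pp. 1089–1090] -/
theorem summable_norm_of_majC {G : PowerSeries ℂ} {qb a : ℝ} (h : MajC G (expMaj qb a)) (s : ℝ) :
    Summable (fun N => ‖PowerSeries.coeff N G * (s : ℂ) ^ N‖) := by
  refine Summable.of_nonneg_of_le (fun N => norm_nonneg _) (fun N => ?_)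
    ((Real.summable_pow_div_factorial (a * |s|)).mul_left qb)
  rw [norm_mul, norm_pow, Complex.norm_real, Real.norm_eq_abs]
  have hN := h N
  rw [coeff_expMaj] at hN
  calc ‖PowerSeries.coeff N G‖ * |s| ^ N ≤ (qb * a ^ N / (N ! : ℝ)) * |s| ^ N :=
        mul_le_mul_of_nonneg_right hN (by positivity)
    _ = qb * ((a * |s|) ^ N / (N ! : ℝ)) := by rw [mul_pow]; ring

/-- **Cauchy product**: the coefficient sums multiply (absolutely summable factors).
[cite: FitznerVanDerHofstad2016NoBLE, §5.1.1 (5.4)–(5.5) pp. 1089–1090] -/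
theorem hasSum_coeff_mul {G H : PowerSeries ℂ} {s : ℝ} {x y : ℂ}
    (hG : HasSum (fun N => PowerSeries.coeff N G * (s : ℂ) ^ N) x)
    (hGn : Summable (fun N => ‖PowerSeries.coeff N G * (s : ℂ) ^ N‖))
    (hH : HasSum (fun N => PowerSeries.coeff N H * (s : ℂ) ^ N) y)
    (hHn : Summable (fun N => ‖PowerSeries.coeff N H * (s : ℂ) ^ N‖)) :
    HasSum (fun N => PowerSeries.coeff N (G * H) * (s : ℂ) ^ N) (x * y) := by
  have hprod := tsum_mul_tsum_eq_tsum_sum_antidiagonal_of_summable_norm hGn hHn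
  rw [hG.tsum_eq, hH.tsum_eq] at hprod
  have hhs := (summable_norm_sum_mul_antidiagonal_of_summable_norm hGn hHn).of_norm.hasSum
  rw [← hprod] at hhs
  refine hhs.congr_fun fun N => ?_
  rw [PowerSeries.coeff_mul, sum_mul]
  refine sum_congr rfl fun kl hkl => ?_
  rw [mem_antidiagonal] at hkl
  rw [← hkl, pow_add]
  ring

/-- **The class powers**: `Σ_N [s^N]G_a^p · s^N = Φ_a(s)^p` (`p ≥ 1`).
[cite: FitznerVanDerHofstad2016NoBLE, §5.1.1 (5.4)–(5.5) pp. 1089–1090] -/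
theorem hasSum_coeff_twG2_pow (m J : ℕ) (Q : ℕ → ℤ) (q : ℕ) (hm : 0 < m)
    (hQ : ∀ j, j ≤ J → (Q j).natAbs ≤ q) (a : ℕ) (s : ℝ) : ∀ p : ℕ, 1 ≤ p →
    HasSum (fun N => PowerSeries.coeff N (twG2 m J Q a ^ p) * (s : ℂ) ^ N) (twRowFun2 m J Q a s ^ p)
  | 0, h => absurd h (by omega)
  | 1, _ => by simpa only [pow_one] using hasSum_coeff_twG2 m J Q a s
  | p + 2, _ => by
      have ih := hasSum_coeff_twG2_pow m J Q q hm hQ a s (p + 1) (by omega)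
      have h1 := hasSum_coeff_twG2 m J Q a s
      have hmaj := majC_twG2 m J Q q hm hQ a
      have hf : Summable (fun N => ‖PowerSeries.coeff N (twG2 m J Q a ^ (p + 1)) * (s : ℂ) ^ N‖) := by
        have := majC_pow hmaj (p + 1)
        rw [expMaj_pow _ _ _ (by omega)] at this
        exact summable_norm_of_majC this s
      have hg := summable_norm_of_majC hmaj s
      rw [pow_succ, pow_succ (twRowFun2 m J Q a s)]
      exact hasSum_coeff_mul ih hf h1 hg

/-- **The formal product sums to the analytic product**: `Σ_N [s^N]F · s^N = ∏_r Φ_{a_r}(s)^{p_r}`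
(positive multiplicities). [cite: FitznerVanDerHofstad2016NoBLE, §5.1.1 (5.4)–(5.5) pp. 1089–1090] -/
theorem hasSum_coeff_prF (m J : ℕ) (Q : ℕ → ℤ) (q : ℕ) (hm : 0 < m)
    (hQ : ∀ j, j ≤ J → (Q j).natAbs ≤ q) (s : ℝ) :
    ∀ cls : List (ℕ × ℕ), (∀ ap ∈ cls, 1 ≤ ap.2) →
      HasSum (fun N => PowerSeries.coeff N (prF m J Q cls) * (s : ℂ) ^ N) (prFFun m J Q s cls)
  | [], _ => by
      have h : HasSum (fun N => PowerSeries.coeff N (1 : PowerSeries ℂ) * (s : ℂ) ^ N)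
          (PowerSeries.coeff 0 (1 : PowerSeries ℂ) * (s : ℂ) ^ 0) :=
        hasSum_single 0 (fun N hN => by rw [PowerSeries.coeff_one, if_neg hN, zero_mul])
      simpa [prF, prFFun, PowerSeries.coeff_one] using h
  | (a, p) :: t, hps => by
      have hp : 1 ≤ p := hps (a, p) (List.mem_cons_self)
      have hps' : ∀ ap ∈ t, 1 ≤ ap.2 := fun ap hap => hps ap (List.mem_cons_of_mem _ hap)
      have h1 := hasSum_coeff_twG2_pow m J Q q hm hQ a s p hp
      have hf : Summable (fun N => ‖PowerSeries.coeff N (twG2 m J Q a ^ p) * (s : ℂ) ^ N‖) := by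
        have := majC_pow (majC_twG2 m J Q q hm hQ a) p
        rw [expMaj_pow _ _ _ hp] at this
        exact summable_norm_of_majC this s
      have h2 := hasSum_coeff_prF m J Q q hm hQ s t hps'
      have hg := summable_norm_of_majC (majC_prF m J Q q hm hQ t hps') s
      rw [prF, prFFun]
      exact hasSum_coeff_mul h1 hf h2 hg

end Analytic

end Literature.Probability.FitznerVanDerHofstad2017.SeedCert
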